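import Summits.AtomisticToContinuum.Crystallization.Theses.GappedShellCensus
import Literature.Probability.Process.LocalRubberCompact
import Literature.Probability.Process.LocalRubberHardCore
import Literature.MathematicalPhysics.StatisticalMechanics.LocalMatchingCompactness

/-!
# Candidate proof (Line B, `semicontinuous-census`) of the crux
# `GappedShellCensus.CleanLimitExtractionR` (stmt-AtomisticToContinuum-18072)

`theorem cleanLimitExtractionR_candidate : CleanLimitExtractionR` — crux-ideate r1, ideator 1.
Imports: the route file and three Literature files only (no `Cruxes/` workfile is importable, so the
hull dictionary, the collar transfer of gapped-twelve, the covariance / index / counting lemmas of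
the pre-repair workfile `Cruxes/CleanLimitExtraction/SketchIdeator2.lean` (ideator 2 of
stmt-15933, rc 0 there) are COPIED verbatim in §3–§5; §1, §2 and §6 are this seat's).

Line B in one paragraph.  Counting (RadialDefectsVanish at ONE scale `a`) + compactness give a
rooted all-gapped-twelve hull element `Y₀`; `TornFree` (≥ 4) and `FiveFoldRationingR` (≤ 4) make
every bond EXACTLY FOUR-REGULAR on balls `B(c_m, m)` of `Y₀`; re-root at `c_m`, extract again: the
limit `Y` is all-gapped-twelve (collar transfer, a bijection — landed as `stub_cleGappedOfLimit`,
here `gappedTwelve_of_tendsto`) and all-four-regular, because a LOWER bound on a common-neighbour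
count is pushed through a fine matching by an INJECTION alone (`commonNbrs_le_transfer`, used once
from `Y` into an approximant and once back); only then is `ShellTrichotomy` applied, IN `Y`, where
the degree dictionary `shellDegree_eq_commonNbrs` kills branches (B) `≥ 5` and (C) `≤ 3`.  No
typing-closedness, no compactness of `O(3)`, no pattern crosses a limit.
-/

noncomputable section

open Filter Topology Set
open scoped omegaLimit

namespace Summit.AtomisticToContinuum.Crystallization.Cruxes.CleanLimitExtractionR.CandidateB

open Literature.Probability.Process Literature.MathematicalPhysics.StatisticalMechanics
  Literature.Geometry.DiscreteGeometry
open Summit.AtomisticToContinuum.Crystallization.Theses.GappedShellCensus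

/-- Euclidean 3-space. -/
abbrev E3 := EuclideanSpace ℝ (Fin 3)

/-! ## §0 The route's inlined site predicates, named (verbatim clauses) -/

/-- GAPPED-TWELVE at scale `a` (the route's clause for a site `y` of `Y`). -/
def GappedTwelve (a : ℝ) (Y : Set E3) (y : E3) : Prop :=
  {w ∈ Y | w ≠ y ∧ dist y w ≤ a * (1 + 1 / 50)}.ncard = 12 ∧
    ∀ w ∈ Y, w ≠ y → a * (1 - 1 / 50) ≤ dist y w ∧
      (dist y w ≤ a * (1 + 1 / 50) ∨ a * (63 / 50) ≤ dist y w)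

/-- The rescaled bond shell of `y` is `1/5`-close to fcc or hcp (the route's typing clause). -/
def FccHcpShell (a : ℝ) (Y : Set E3) (y : E3) : Prop :=
  ∃ T : Finset E3, (↑T : Set E3) = (fun w => a⁻¹ • (w - y)) '' {w ∈ Y | w ≠ y ∧ dist y w ≤ a * (1 + 1 / 50)} ∧
    (ShellCloseTo (1 / 5) T fccKissingPattern ∨ ShellCloseTo (1 / 5) T hcpKissingPattern)

/-- The common bonded neighbours of the bond `(y, v)`. -/
def CommonNbrs (a : ℝ) (Y : Set E3) (y v : E3) : Set E3 :=
  {w ∈ Y | w ≠ y ∧ w ≠ v ∧ dist y w ≤ a * (1 + 1 / 50) ∧ dist v w ≤ a * (1 + 1 / 50)}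

/-- FOUR-REGULAR SITE: gapped-twelve, and every bond at `y` has exactly four common neighbours
(the combinatorial predicate that crosses the second limit). -/
def FourRegSite (a : ℝ) (Y : Set E3) (y : E3) : Prop :=
  GappedTwelve a Y y ∧
    ∀ v ∈ Y, v ≠ y → dist y v ≤ a * (1 + 1 / 50) → (CommonNbrs a Y y v).ncard = 4

/-! ## §1 The finite dictionary (typing in situ; this seat, PROVED) -/

/-- The rescaling `w ↦ a⁻¹ • (w - y)` is injective. -/
theorem rescale_injective {a : ℝ} (ha : 0 < a) (y : E3) :
    Function.Injective fun w : E3 => a⁻¹ • (w - y) := fun u v huv => by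
  have h := smul_right_injective E3 (inv_ne_zero ha.ne') huv
  exact sub_left_injective h

/-- Distances rescale: `dist (a⁻¹(v-y)) (a⁻¹(w-y)) = a⁻¹ dist v w`. -/
theorem dist_rescale {a : ℝ} (ha : 0 < a) (y v w : E3) :
    dist (a⁻¹ • (v - y)) (a⁻¹ • (w - y)) = a⁻¹ * dist v w := by
  rw [dist_smul₀, norm_inv, Real.norm_of_nonneg ha.le, dist_sub_right]

/-- THE RESCALED SHELL satisfies the three typing hypotheses of `ShellTrichotomy` at every site of
an all-gapped-twelve configuration (twelve points; radii in `[0.98, 1.02]`; mutual distances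
admissible because every shell point is itself a gapped-twelve site). PROVED. -/
theorem rescaledShell_hyps {Y : Set E3} {a : ℝ} (ha : 0 < a)
    (hgood : ∀ y ∈ Y, GappedTwelve a Y y) {y : E3} (hy : y ∈ Y) :
    ∃ T : Finset E3,
      (↑T : Set E3) = (fun w => a⁻¹ • (w - y)) '' {w ∈ Y | w ≠ y ∧ dist y w ≤ a * (1 + 1 / 50)} ∧
      T.card = 12 ∧ (∀ v ∈ T, 1 - 1 / 50 ≤ ‖v‖ ∧ ‖v‖ ≤ 1 + 1 / 50) ∧
      (∀ v ∈ T, ∀ w ∈ T, v ≠ w → 1 - 1 / 50 ≤ dist v w ∧ (dist v w ≤ 1 + 1 / 50 ∨ 63 / 50 ≤ dist v w)) := by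
  obtain ⟨hcount, hrad⟩ := hgood y hy
  have hfin : {w ∈ Y | w ≠ y ∧ dist y w ≤ a * (1 + 1 / 50)}.Finite :=
    Set.finite_of_ncard_ne_zero (by rw [hcount]; norm_num)
  have hfinT := hfin.image (fun w => a⁻¹ • (w - y))
  refine ⟨hfinT.toFinset, hfinT.coe_toFinset, ?_, ?_, ?_⟩
  · rw [← Set.ncard_coe_finset, hfinT.coe_toFinset, Set.ncard_image_of_injective _ (rescale_injective ha y),
      hcount]
  · intro v hv
    rw [Set.Finite.mem_toFinset] at hv
    obtain ⟨w, ⟨hw, hwy, hd⟩, rfl⟩ := hv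
    have hlo := (hrad w hw hwy).1
    rw [norm_smul, norm_inv, Real.norm_of_nonneg ha.le, ← dist_eq_norm, dist_comm]
    constructor
    · rw [le_inv_mul_iff₀ ha]; linarith
    · rw [inv_mul_le_iff₀ ha]; linarith
  · intro v hv v' hv' hvv'
    rw [Set.Finite.mem_toFinset] at hv hv'
    obtain ⟨w, ⟨hw, hwy, hd⟩, rfl⟩ := hv
    obtain ⟨w', ⟨hw', hw'y, hd'⟩, rfl⟩ := hv'
    have hww' : w ≠ w' := fun h => hvv' (by rw [h])
    obtain ⟨h1, h2⟩ := (hgood w hw).2 w' hw' (Ne.symm hww')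
    rw [dist_rescale ha]
    refine ⟨by rw [le_inv_mul_iff₀ ha]; linarith, ?_⟩
    rcases h2 with h | h
    · left; rw [inv_mul_le_iff₀ ha]; linarith
    · right; rw [le_inv_mul_iff₀ ha]; linarith

/-- THE DEGREE DICTIONARY (the crux's named bookkeeping step): for a bond `(y, v)`, the shell-degree
of `a⁻¹(v - y)` inside the rescaled shell `T` of `y` equals the number of common bonded neighbours
of `y` and `v`. PROVED. -/
theorem shellDegree_eq_commonNbrs {Y : Set E3} {a : ℝ} (ha : 0 < a) {y : E3}
    {T : Finset E3}
    (hT : (↑T : Set E3) = (fun w => a⁻¹ • (w - y)) '' {w ∈ Y | w ≠ y ∧ dist y w ≤ a * (1 + 1 / 50)})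
    {v : E3} (hv : v ∈ Y) (hvy : v ≠ y) (hdv : dist y v ≤ a * (1 + 1 / 50)) :
    (T.filter fun w' => w' ≠ a⁻¹ • (v - y) ∧ dist (a⁻¹ • (v - y)) w' ≤ 1 + 1 / 50).card =
      (CommonNbrs a Y y v).ncard := by
  classical
  have hfinj : Function.Injective (fun w : E3 => a⁻¹ • (w - y)) := rescale_injective ha y
  -- the filtered Finset, as a set, is the image of the common-neighbour set
  have key : (↑(T.filter fun w' => w' ≠ a⁻¹ • (v - y) ∧ dist (a⁻¹ • (v - y)) w' ≤ 1 + 1 / 50) : Set E3) =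
      (fun w : E3 => a⁻¹ • (w - y)) '' CommonNbrs a Y y v := by
    rw [Finset.coe_filter]
    ext w'
    constructor
    · rintro ⟨hw'T, hne, hdist⟩
      have hw'T' : w' ∈ (fun w : E3 => a⁻¹ • (w - y)) '' {w ∈ Y | w ≠ y ∧ dist y w ≤ a * (1 + 1 / 50)} := by
        rw [← hT]; exact hw'T
      simp only [Set.mem_image, Set.mem_setOf_eq] at hw'T'
      obtain ⟨w, ⟨hw, hwy, hdw⟩, rfl⟩ := hw'T'
      refine ⟨w, ⟨hw, hwy, ?_, hdw, ?_⟩, rfl⟩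
      · intro h; apply hne; rw [h]
      · rw [dist_rescale ha, inv_mul_le_iff₀ ha] at hdist
        linarith
    · rintro ⟨w, ⟨hw, hwy, hwv, hdw, hdvw⟩, rfl⟩
      refine ⟨?_, ?_, ?_⟩
      · show a⁻¹ • (w - y) ∈ (↑T : Set E3)
        rw [hT]
        exact ⟨w, ⟨hw, hwy, hdw⟩, rfl⟩
      · intro h; exact hwv (hfinj h)
      · show dist (a⁻¹ • (v - y)) (a⁻¹ • (w - y)) ≤ 1 + 1 / 50
        rw [dist_rescale ha, inv_mul_le_iff₀ ha]
        linarith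
  rw [← Set.ncard_coe_finset, key, Set.ncard_image_of_injective _ hfinj]

/-- TYPING IN SITU: at a site all of whose bonds have EXACTLY four common neighbours,
`ShellTrichotomy` leaves only branch (A): the rescaled shell is `1/5`-close to fcc or hcp.
(Branches (B) `≥ 5` and (C) `≤ 3` are read through the degree dictionary.) PROVED. -/
theorem fccHcpShell_of_fourRegular (hST : ShellTrichotomy) {Y : Set E3} {a : ℝ} (ha : 0 < a)
    (hgood : ∀ y ∈ Y, GappedTwelve a Y y) {y : E3} (hy : y ∈ Y)
    (h4 : ∀ v ∈ Y, v ≠ y → dist y v ≤ a * (1 + 1 / 50) → (CommonNbrs a Y y v).ncard = 4) :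
    FccHcpShell a Y y := by
  classical
  obtain ⟨T, hT, hcard, hnorm, hpair⟩ := rescaledShell_hyps ha hgood hy
  refine ⟨T, hT, ?_⟩
  -- a shell point `v' ∈ T` comes from a bond `(y, v)`
  have hpre : ∀ v' ∈ T, ∃ v ∈ Y, v ≠ y ∧ dist y v ≤ a * (1 + 1 / 50) ∧ v' = a⁻¹ • (v - y) := by
    intro v' hv'
    have hv'T : v' ∈ (↑T : Set E3) := hv'
    rw [hT] at hv'T
    obtain ⟨v, ⟨hv, hvy, hdv⟩, rfl⟩ := hv'T
    exact ⟨v, hv, hvy, hdv, rfl⟩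
  rcases hST T hcard hnorm hpair with hA | hA | hB | hC
  · exact Or.inl hA
  · exact Or.inr hA
  · exfalso
    obtain ⟨v', hv', h5⟩ := hB
    obtain ⟨v, hv, hvy, hdv, rfl⟩ := hpre v' hv'
    rw [shellDegree_eq_commonNbrs ha hT hv hvy hdv, h4 v hv hvy hdv] at h5
    omega
  · exfalso
    obtain ⟨v', hv', h3⟩ := hC
    obtain ⟨v, hv, hvy, hdv, rfl⟩ := hpre v' hv'
    rw [shellDegree_eq_commonNbrs ha hT hv hvy hdv, h4 v hv hvy hdv] at h3
    omega


/-! ## §2 Only an injection crosses the last limit (this seat, PROVED) -/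

/-- **FIRST LEMMA of card `semicontinuous-census`** (finite, limit-free, ONE-WAY matching):
if `S` is `δ`-separated and matched INTO `S'` within `η` on `B(0, R)` (`2η < δ`, `25η < a`), and
`S'` is radially admissible at scale `a` on `B(0, R + η)`, then a bond `(y, v)` of `S` deep inside
the ball with at least `n` common bonded neighbours is matched to a bond `(y', v')` of `S'` with at
least `n` common bonded neighbours: lower bounds on common-neighbour counts are pushed forward by
the matching injection, the gap `(1.02a, 1.26a)` of `S'` absorbing the `2η` distortion.  Applied
from the limit `Y` into the approximants it makes `≤ 4` pass TO the limit; applied from the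
approximants into `Y` it makes `≥ 4` pass to the limit. (To be proved by the line; the proof is
the injectivity half of the workfile's `gappedTwelve_transfer`.) -/
theorem commonNbrs_le_transfer {S S' : Set E3} {a δ η R : ℝ} (ha : 0 < a) (hδ : 0 < δ)
    (hη : 0 ≤ η) (h2η : 2 * η < δ) (hηa : 25 * η < a)
    (hS : ∀ u ∈ S, ∀ w ∈ S, u ≠ w → δ ≤ dist u w)
    (hS' : ∀ u ∈ S', ∀ w ∈ S', u ≠ w → δ ≤ dist u w)
    (hm : ∀ q ∈ S, ‖q‖ ≤ R → ∃ p ∈ S', dist q p ≤ η)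
    (hrad : ∀ p ∈ S', ‖p‖ ≤ R + η → ∀ w ∈ S', w ≠ p →
      a * (1 - 1 / 50) ≤ dist p w ∧ (dist p w ≤ a * (1 + 1 / 50) ∨ a * (63 / 50) ≤ dist p w))
    {y v : E3} (hy : y ∈ S) (hv : v ∈ S) (hvy : v ≠ y) (hdv : dist y v ≤ a * (1 + 1 / 50))
    (hR : ‖y‖ + 3 * a ≤ R) {n : ℕ} (hn : n ≤ (CommonNbrs a S y v).ncard) :
    ∃ y' ∈ S', ∃ v' ∈ S', dist y y' ≤ η ∧ dist v v' ≤ η ∧ v' ≠ y' ∧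
      dist y' v' ≤ a * (1 + 1 / 50) ∧ n ≤ (CommonNbrs a S' y' v').ncard := by
  classical
  -- distortion of distances under the matching
  have hdist : ∀ {p q p' q' : E3}, dist p p' ≤ η → dist q q' ≤ η →
      dist p' q' ≤ dist p q + 2 * η ∧ dist p q ≤ dist p' q' + 2 * η := by
    intro p q p' q' hp hq
    have h := dist_dist_dist_le p' q' p q
    rw [Real.dist_eq, dist_comm p' p, dist_comm q' q] at h
    obtain ⟨h1, h2⟩ := abs_sub_le_iff.1 (h.trans (add_le_add hp hq))
    constructor <;> linarith
  -- partners of distinct points of `S` are distinct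
  have hne_of : ∀ {p q p' q' : E3}, p ∈ S → q ∈ S → p ≠ q → dist p p' ≤ η → dist q q' ≤ η →
      p' ≠ q' := by
    intro p q p' q' hp hq hpq hpp' hqq' h
    have hsep := hS p hp q hq hpq
    have := (hdist hpp' hqq').2
    rw [h, dist_self] at this
    linarith
  -- the gap of `S'` absorbs the distortion: a near-bond of `S'` is a bond
  have hbond : ∀ p' ∈ S', ‖p'‖ ≤ R + η → ∀ q' ∈ S', q' ≠ p' →
      dist p' q' ≤ a * (1 + 1 / 50) + 2 * η → dist p' q' ≤ a * (1 + 1 / 50) := by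
    intro p' hp' hp'R q' hq' hne hle
    rcases (hrad p' hp' hp'R q' hq' hne).2 with h | h
    · exact h
    · exfalso; linarith
  -- norms of the players
  have hyR : ‖y‖ ≤ R := by linarith
  have hvR : ‖v‖ ≤ R := by
    have h1 := norm_sub_norm_le v y
    rw [← dist_eq_norm, dist_comm] at h1
    linarith
  obtain ⟨y', hy'S, hyy'⟩ := hm y hy hyR
  obtain ⟨v', hv'S, hvv'⟩ := hm v hv hvR
  have hy'R : ‖y'‖ ≤ R + η := by
    have h1 := norm_sub_norm_le y' y
    rw [← dist_eq_norm, dist_comm] at h1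
    linarith
  have hv'R : ‖v'‖ ≤ R + η := by
    have h1 := norm_sub_norm_le v' v
    rw [← dist_eq_norm, dist_comm] at h1
    linarith
  have hv'y' : v' ≠ y' := fun h => hne_of hy hv (Ne.symm hvy) hyy' hvv' h.symm
  have hdy'v' : dist y' v' ≤ a * (1 + 1 / 50) :=
    hbond y' hy'S hy'R v' hv'S hv'y' (by linarith [(hdist hyy' hvv').1])
  -- every common neighbour of `(y, v)` has a partner that is a common neighbour of `(y', v')`
  have hpart : ∀ w ∈ CommonNbrs a S y v, ∃ w' ∈ CommonNbrs a S' y' v', dist w w' ≤ η := by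
    rintro w ⟨hwS, hwy, hwv, hdyw, hdvw⟩
    have hwR : ‖w‖ ≤ R := by
      have h1 := norm_sub_norm_le w y
      rw [← dist_eq_norm, dist_comm] at h1
      linarith
    obtain ⟨w', hw'S, hww'⟩ := hm w hwS hwR
    have hw'y' : w' ≠ y' := fun h => hne_of hwS hy hwy hww' hyy' h
    have hw'v' : w' ≠ v' := fun h => hne_of hwS hv hwv hww' hvv' h
    refine ⟨w', ⟨hw'S, hw'y', hw'v', ?_, ?_⟩, hww'⟩
    · exact hbond y' hy'S hy'R w' hw'S hw'y' (by linarith [(hdist hyy' hww').1])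
    · exact hbond v' hv'S hv'R w' hw'S hw'v' (by linarith [(hdist hvv' hww').1])
  choose! g hg using hpart
  have hginj : Set.InjOn g (CommonNbrs a S y v) := by
    intro w₁ h₁ w₂ h₂ heq
    by_contra hne
    have hsep := hS w₁ h₁.1 w₂ h₂.1 hne
    have : dist w₁ w₂ ≤ 2 * η :=
      calc dist w₁ w₂ ≤ dist w₁ (g w₁) + dist w₂ (g w₁) := dist_triangle_right _ _ _
        _ ≤ η + η := by
            gcongr
            · exact (hg w₁ h₁).2
            · rw [heq]; exact (hg w₂ h₂).2
        _ = 2 * η := by ring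
    linarith
  -- the target is finite (separated subset of a ball)
  have hfin : (CommonNbrs a S' y' v').Finite := by
    refine finite_of_forall_le_dist_of_subset_closedBall hδ
      (fun u hu w hw huw => hS' u hu.1 w hw.1 huw) (c := y') (R := a * (1 + 1 / 50)) ?_
    intro w hw
    exact Metric.mem_closedBall.2 (by rw [dist_comm]; exact hw.2.2.2.1)
  exact ⟨y', hy'S, v', hv'S, hyy', hvv', hv'y', hdy'v',
    hn.trans (Set.ncard_le_ncard_of_injOn g (fun w hw => (hg w hw).1) hginj hfin)⟩

/-- Card `semicontinuous-census`, the closedness it buys: EXACT FOUR-REGULARITY of all bonds at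
a site is closed under local-rubber limits of `δ`-separated configurations that are
gapped-twelve and four-regular on growing balls, the limit being all-gapped-twelve (landed
`stub_cleGappedOfLimit` / workfile `gappedTwelve_of_tendsto`).  Proof = `commonNbrs_le_transfer`
TWICE: from the limit into a fine approximant (`≤ 4` comes back) and from that approximant into
the limit (`≥ 4` comes back), the partners being identified by separation. PROVED. -/
theorem fourRegular_of_tendsto {S : ℕ → LocalConfig E3} {Y : LocalConfig E3} {a δ : ℝ}
    (ha : 0 < a) (hδ : 0 < δ) (hS : ∀ k, ∀ u ∈ S k, ∀ w ∈ S k, u ≠ w → δ ≤ dist u w)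
    (hY : Tendsto S atTop (𝓝 Y)) {y : E3} (hy : y ∈ Y)
    (hgoodY : ∀ z ∈ (Y : Set E3), GappedTwelve a (Y : Set E3) z)
    (hgood : ∀ ρ : ℝ, ∀ᶠ k in atTop, ∀ p ∈ S k, ‖p‖ ≤ ρ → GappedTwelve a (S k : Set E3) p ∧
      ∀ q ∈ S k, q ≠ p → dist p q ≤ a * (1 + 1 / 50) → (CommonNbrs a (S k : Set E3) p q).ncard = 4) :
    ∀ v ∈ (Y : Set E3), v ≠ y → dist y v ≤ a * (1 + 1 / 50) →
      (CommonNbrs a (Y : Set E3) y v).ncard = 4 := by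
  intro v hv hvy hdv
  -- the limit is `δ`-separated (closed class)
  have hYsep : ∀ u ∈ Y, ∀ w ∈ Y, u ≠ w → δ ≤ dist u w :=
    (LocalConfig.isClosed_setOf_separated δ).mem_of_tendsto hY (Eventually.of_forall hS)
  -- a fine matching scale and a radius with room for both transfers
  set η : ℝ := min (δ / 4) (a / 50) with hη_def
  have hη : 0 < η := lt_min (by positivity) (by positivity)
  have hηδ : η ≤ δ / 4 := min_le_left _ _
  have hηa : η ≤ a / 50 := min_le_right _ _
  set R : ℝ := ‖y‖ + 8 * a with hR_def
  obtain ⟨k, hmatch, hgk⟩ :=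
    (((LocalConfig.tendsto_iff_locallyMatches.1 hY) R η hη).and (hgood (R + 1 + a))).exists
  have hradk : ∀ p ∈ (S k : Set E3), ‖p‖ ≤ R + η → ∀ w ∈ (S k : Set E3), w ≠ p →
      a * (1 - 1 / 50) ≤ dist p w ∧ (dist p w ≤ a * (1 + 1 / 50) ∨ a * (63 / 50) ≤ dist p w) :=
    fun p hp hpR w hw hwp => (hgk p hp (by linarith)).1.2 w hw hwp
  have hradY : ∀ p ∈ (Y : Set E3), ‖p‖ ≤ R + η → ∀ w ∈ (Y : Set E3), w ≠ p →
      a * (1 - 1 / 50) ≤ dist p w ∧ (dist p w ≤ a * (1 + 1 / 50) ∨ a * (63 / 50) ≤ dist p w) :=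
    fun p hp _ w hw hwp => (hgoodY p hp).2 w hw hwp
  -- transfer 1: from the limit into the approximant (`≤ 4` comes back)
  obtain ⟨p, hp, q, hq, hyp, hvq, hqp, hdpq, hle⟩ :=
    commonNbrs_le_transfer ha hδ hη.le (by linarith) (by linarith) hYsep (hS k) hmatch.2 hradk
      hy hv hvy hdv (by rw [hR_def]; linarith) le_rfl
  have hpn : ‖p‖ ≤ ‖y‖ + η := by
    have h1 := norm_sub_norm_le p y
    rw [← dist_eq_norm, dist_comm] at h1
    linarith
  have h4k : (CommonNbrs a (S k : Set E3) p q).ncard = 4 :=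
    (hgk p hp (by rw [hR_def] at *; linarith)).2 q hq hqp hdpq
  -- transfer 2: from the approximant into the limit (`≥ 4` comes back)
  have hm' : ∀ q ∈ (S k : Set E3), ‖q‖ ≤ R → ∃ p ∈ (Y : Set E3), dist q p ≤ η := by
    intro q hq hqR
    obtain ⟨p, hp, hd⟩ := hmatch.1 q hq hqR
    exact ⟨p, hp, by rw [dist_comm]; exact hd⟩
  obtain ⟨y', hy', v', hv', hpy', hqv', -, -, hge⟩ :=
    commonNbrs_le_transfer ha hδ hη.le (by linarith) (by linarith) (hS k) hYsep hm' hradY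
      hp hq hqp hdpq (by rw [hR_def] at *; linarith) h4k.ge
  -- the partners of the partners are the original sites (separation of the limit)
  have hyy' : y' = y := by
    by_contra hne
    have hsep := hYsep y' hy' y hy hne
    have : dist y' y ≤ 2 * η :=
      calc dist y' y ≤ dist y' p + dist y p := dist_triangle_right _ _ _
        _ ≤ η + η := by rw [dist_comm y' p]; gcongr
        _ = 2 * η := by ring
    linarith
  have hvv' : v' = v := by
    by_contra hne
    have hsep := hYsep v' hv' v hv hne
    have : dist v' v ≤ 2 * η :=
      calc dist v' v ≤ dist v' q + dist v q := dist_triangle_right _ _ _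
        _ ≤ η + η := by rw [dist_comm v' q]; gcongr
        _ = 2 * η := by ring
    linarith
  subst hyy' hvv'
  exact le_antisymm (hle.trans h4k.le) hge


/-! ## §3 Collar transfer of gapped-twelve (COPIED from the pre-repair workfile, ideator 2 of stmt-15933) -/

/-! ## Card C — the Hales gap makes shell counts continuous: collar transfer -/

/-- FIRST LEMMA of card C: COLLAR TRANSFER (finite, limit-free). Two `δ`-separated configurations
that are two-way `(R, η)`-matched with `2η < δ` have the SAME gapped-twelve status at matched sites,
provided the second one is radially admissible there: the matching restricts to a bijection of the
two bond shells because their boundary spheres `0.98a`, `1.02a` sit inside particle-free collars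
(the hard-core moat below `0.98a` and the Hales gap `(1.02a, 1.26a)`), both wider than `2η`.
PROVED. -/
theorem gappedTwelve_transfer {S S' : Set E3} {a δ η R : ℝ} (ha : 0 < a) (hδ : 0 < δ)
    (hη : 0 ≤ η) (h2η : 2 * η < δ) (hηa : 25 * η < a)
    (hS : ∀ u ∈ S, ∀ v ∈ S, u ≠ v → δ ≤ dist u v)
    (hS' : ∀ u ∈ S', ∀ v ∈ S', u ≠ v → δ ≤ dist u v)
    (hm : LocallyMatches R η S S') {p p' : E3} (hp : p ∈ S) (hp' : p' ∈ S')
    (hpp' : dist p p' ≤ η) (hR : ‖p‖ + 2 * a ≤ R)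
    (hg : GappedTwelve a S p)
    (hrad : ∀ w ∈ S', w ≠ p' → a * (1 - 1 / 50) ≤ dist p' w ∧
      (dist p' w ≤ a * (1 + 1 / 50) ∨ a * (63 / 50) ≤ dist p' w)) :
    GappedTwelve a S' p' := by
  obtain ⟨hcount, hradS⟩ := hg
  refine ⟨?_, hrad⟩
  set A : Set E3 := {w ∈ S | w ≠ p ∧ dist p w ≤ a * (1 + 1 / 50)} with hA
  set B : Set E3 := {w ∈ S' | w ≠ p' ∧ dist p' w ≤ a * (1 + 1 / 50)} with hB
  -- both shells are finite (separated subsets of closed balls)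
  have hAfin : A.Finite := by
    refine finite_of_forall_le_dist_of_subset_closedBall hδ
      (fun u hu v hv huv => hS u hu.1 v hv.1 huv) (c := p) (R := a * (1 + 1 / 50)) ?_
    intro w hw
    exact Metric.mem_closedBall.2 (by rw [dist_comm]; exact hw.2.2)
  have hBfin : B.Finite := by
    refine finite_of_forall_le_dist_of_subset_closedBall hδ
      (fun u hu v hv huv => hS' u hu.1 v hv.1 huv) (c := p') (R := a * (1 + 1 / 50)) ?_
    intro w hw
    exact Metric.mem_closedBall.2 (by rw [dist_comm]; exact hw.2.2)
  have hpp'' : dist p' p ≤ η := by rw [dist_comm]; exact hpp'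
  -- shell of `p` in `S` ↦ shell of `p'` in `S'`
  have hAto : ∀ w ∈ A, ∃ w' ∈ B, dist w w' ≤ η := by
    intro w hw
    obtain ⟨hwS, hwp, hdw⟩ := hw
    have hwR : ‖w‖ ≤ R := by
      have h1 := norm_sub_norm_le w p
      rw [← dist_eq_norm, dist_comm] at h1
      nlinarith [ha]
    obtain ⟨w', hw'S, hww'⟩ := hm.2 w hwS hwR
    have hlow : a * (1 - 1 / 50) ≤ dist p w := (hradS w hwS hwp).1
    have hne : w' ≠ p' := by
      intro h
      rw [h] at hww'
      have : dist p w ≤ dist p p' + dist w p' := dist_triangle_right p w p'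
      nlinarith [ha]
    have hup : dist p' w' ≤ a * (1 + 1 / 50) + 2 * η :=
      calc dist p' w' ≤ dist p' p + dist p w' := dist_triangle _ _ _
        _ ≤ dist p' p + (dist p w + dist w w') := by gcongr; exact dist_triangle _ _ _
        _ ≤ η + (a * (1 + 1 / 50) + η) := by gcongr
        _ = a * (1 + 1 / 50) + 2 * η := by ring
    refine ⟨w', ⟨hw'S, hne, ?_⟩, hww'⟩
    rcases (hrad w' hw'S hne).2 with h | h
    · exact h
    · exfalso; nlinarith [ha]
  -- shell of `p'` in `S'` ↦ shell of `p` in `S`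
  have hBto : ∀ w' ∈ B, ∃ w ∈ A, dist w w' ≤ η := by
    intro w' hw'
    obtain ⟨hw'S, hw'p, hdw'⟩ := hw'
    have hw'R : ‖w'‖ ≤ R := by
      have h1 := norm_sub_norm_le w' p'
      rw [← dist_eq_norm, dist_comm] at h1
      have h2 := norm_sub_norm_le p' p
      rw [← dist_eq_norm] at h2
      nlinarith [ha]
    obtain ⟨w, hwS, hww'⟩ := hm.1 w' hw'S hw'R
    have hlow : a * (1 - 1 / 50) ≤ dist p' w' := (hrad w' hw'S hw'p).1
    have hne : w ≠ p := by
      intro h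
      rw [h] at hww'
      have : dist p' w' ≤ dist p' p + dist p w' := dist_triangle _ _ _
      nlinarith [ha]
    have hup : dist p w ≤ a * (1 + 1 / 50) + 2 * η :=
      calc dist p w ≤ dist p p' + dist p' w := dist_triangle _ _ _
        _ ≤ dist p p' + (dist p' w' + dist w' w) := by gcongr; exact dist_triangle _ _ _
        _ ≤ η + (a * (1 + 1 / 50) + η) := by gcongr; rw [dist_comm]; exact hww'
        _ = a * (1 + 1 / 50) + 2 * η := by ring
    refine ⟨w, ⟨hwS, hne, ?_⟩, hww'⟩
    rcases (hradS w hwS hne).2 with h | h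
    · exact h
    · exfalso; nlinarith [ha]
  -- the two maps are injective because `2η < δ`
  choose! f hf using hAto
  choose! g hg using hBto
  have hfinj : Set.InjOn f A := by
    intro w₁ h₁ w₂ h₂ heq
    by_contra hne
    have hsep := hS w₁ h₁.1 w₂ h₂.1 hne
    have : dist w₁ w₂ ≤ 2 * η :=
      calc dist w₁ w₂ ≤ dist w₁ (f w₁) + dist w₂ (f w₁) := dist_triangle_right _ _ _
        _ ≤ η + η := by
            gcongr
            · exact (hf w₁ h₁).2
            · rw [heq]; exact (hf w₂ h₂).2
        _ = 2 * η := by ring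
    linarith
  have hginj : Set.InjOn g B := by
    intro w₁ h₁ w₂ h₂ heq
    by_contra hne
    have hsep := hS' w₁ h₁.1 w₂ h₂.1 hne
    have : dist w₁ w₂ ≤ 2 * η :=
      calc dist w₁ w₂ ≤ dist (g w₁) w₁ + dist (g w₁) w₂ := dist_triangle_left _ _ _
        _ ≤ η + η := by
            gcongr
            · exact (hg w₁ h₁).2
            · rw [heq]; exact (hg w₂ h₂).2
        _ = 2 * η := by ring
    linarith
  have h1 : A.ncard ≤ B.ncard := Set.ncard_le_ncard_of_injOn f (fun w hw => (hf w hw).1) hfinj hBfin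
  have h2 : B.ncard ≤ A.ncard := Set.ncard_le_ncard_of_injOn g (fun w hw => (hg w hw).1) hginj hAfin
  omega

/-- Radial admissibility is CLOSED along local-rubber limits (the allowed distance set
`{0} ∪ [0.98a, 1.02a] ∪ [1.26a, ∞)` is closed) — the cheap half. PROVED. -/
theorem radial_of_tendsto {S : ℕ → LocalConfig E3} {Y : LocalConfig E3} {a δ : ℝ} (ha : 0 < a)
    (hδ : 0 < δ) (hS : ∀ k, ∀ u ∈ S k, ∀ v ∈ S k, u ≠ v → δ ≤ dist u v)
    (hY : Tendsto S atTop (𝓝 Y)) {y : E3} {r : ℝ} (hy : y ∈ Y) (hyr : ‖y‖ < r)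
    (hgood : ∀ᶠ k in atTop, ∀ p ∈ S k, ‖p‖ ≤ r → GappedTwelve a (S k : Set E3) p) :
    ∀ w ∈ (Y : Set E3), w ≠ y → a * (1 - 1 / 50) ≤ dist y w ∧
      (dist y w ≤ a * (1 + 1 / 50) ∨ a * (63 / 50) ≤ dist y w) := by
  intro w hw hne
  have hyw : 0 < dist y w := dist_pos.2 (Ne.symm hne)
  have hr : 0 < r - ‖y‖ := by linarith
  -- key approximation: at every small scale `η` the distance `dist y w` is `2η`-close to an admissible one
  have key : ∀ η : ℝ, 0 < η → η ≤ r - ‖y‖ → 2 * η < dist y w →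
      ∃ d : ℝ, |d - dist y w| ≤ 2 * η ∧ a * (1 - 1 / 50) ≤ d ∧
        (d ≤ a * (1 + 1 / 50) ∨ a * (63 / 50) ≤ d) := by
    intro η hη hηr hη2
    obtain ⟨k, hmatch, hgk⟩ :=
      (((LocalConfig.tendsto_iff_locallyMatches.1 hY) (max ‖y‖ ‖w‖) η hη).and hgood).exists
    obtain ⟨p, hp, hyp⟩ := hmatch.2 y hy (le_max_left _ _)
    obtain ⟨q, hq, hwq⟩ := hmatch.2 w hw (le_max_right _ _)
    have hpq : p ≠ q := by
      intro h
      rw [h] at hyp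
      have : dist y w ≤ dist y q + dist w q := dist_triangle_right _ _ _
      linarith
    have hpnorm : ‖p‖ ≤ r := by
      have h1 := norm_sub_norm_le p y
      rw [← dist_eq_norm, dist_comm] at h1
      linarith
    obtain ⟨-, hradS⟩ := hgk p hp hpnorm
    obtain ⟨hlo, hdisj⟩ := hradS q hq (Ne.symm hpq)
    refine ⟨dist p q, ?_, hlo, hdisj⟩
    rw [abs_sub_le_iff]
    constructor
    · have : dist p q ≤ dist p y + (dist y w + dist w q) :=
        (dist_triangle p y q).trans (by gcongr; exact dist_triangle _ _ _)
      rw [dist_comm p y] at this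
      linarith
    · have : dist y w ≤ dist y p + (dist p q + dist q w) :=
        (dist_triangle y p w).trans (by gcongr; exact dist_triangle _ _ _)
      rw [dist_comm q w] at this
      linarith
  have hlow : a * (1 - 1 / 50) ≤ dist y w := by
    refine le_of_forall_pos_lt_add fun ε hε => ?_
    have hm0 : 0 < min (r - ‖y‖) (min (dist y w / 4) (ε / 4)) :=
      lt_min hr (lt_min (by linarith) (by linarith))
    have hm1 : min (r - ‖y‖) (min (dist y w / 4) (ε / 4)) ≤ dist y w / 4 :=
      (min_le_right _ _).trans (min_le_left _ _)
    have hm2 : min (r - ‖y‖) (min (dist y w / 4) (ε / 4)) ≤ ε / 4 :=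
      (min_le_right _ _).trans (min_le_right _ _)
    obtain ⟨d, hd, hlo, -⟩ := key _ hm0 (min_le_left _ _) (by linarith)
    have h1 := (abs_sub_le_iff.1 hd).1
    linarith
  refine ⟨hlow, ?_⟩
  by_cases hcase : dist y w ≤ a * (1 + 1 / 50)
  · exact Or.inl hcase
  · right
    push Not at hcase
    refine le_of_forall_pos_lt_add fun ε hε => ?_
    have hgap0 : 0 < dist y w - a * (1 + 1 / 50) := by linarith
    have hm0 : 0 < min (r - ‖y‖) (min (dist y w / 4) (min (ε / 4) ((dist y w - a * (1 + 1 / 50)) / 4))) :=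
      lt_min hr (lt_min (by linarith) (lt_min (by linarith) (by linarith)))
    have hm1 : min (r - ‖y‖) (min (dist y w / 4) (min (ε / 4) ((dist y w - a * (1 + 1 / 50)) / 4))) ≤
        dist y w / 4 := (min_le_right _ _).trans (min_le_left _ _)
    have hm2 : min (r - ‖y‖) (min (dist y w / 4) (min (ε / 4) ((dist y w - a * (1 + 1 / 50)) / 4))) ≤
        ε / 4 := ((min_le_right _ _).trans (min_le_right _ _)).trans (min_le_left _ _)
    have hm3 : min (r - ‖y‖) (min (dist y w / 4) (min (ε / 4) ((dist y w - a * (1 + 1 / 50)) / 4))) ≤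
        (dist y w - a * (1 + 1 / 50)) / 4 :=
      ((min_le_right _ _).trans (min_le_right _ _)).trans (min_le_right _ _)
    obtain ⟨d, hd, -, hdisj⟩ := key _ hm0 (min_le_left _ _) (by linarith)
    obtain ⟨h1, h2⟩ := abs_sub_le_iff.1 hd
    rcases hdisj with h | h
    · exfalso
      linarith
    · linarith

/-- GAPPED-TWELVE IS CLOSED under local-rubber limits of `δ`-separated configurations (sitewise,
with radius loss): `radial_of_tendsto` + `gappedTwelve_transfer` applied to a fine matching
(`tendsto_iff_locallyMatches`). This is hypothesis `hclG` of the schema for `Good := GappedTwelve a`.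
PROVED. -/
theorem gappedTwelve_of_tendsto {S : ℕ → LocalConfig E3} {Y : LocalConfig E3} {a δ : ℝ}
    (ha : 0 < a) (hδ : 0 < δ) (hS : ∀ k, ∀ u ∈ S k, ∀ v ∈ S k, u ≠ v → δ ≤ dist u v)
    (hY : Tendsto S atTop (𝓝 Y)) {y : E3} {r : ℝ} (hy : y ∈ Y) (hyr : ‖y‖ < r)
    (hgood : ∀ᶠ k in atTop, ∀ p ∈ S k, ‖p‖ ≤ r → GappedTwelve a (S k : Set E3) p) :
    GappedTwelve a (Y : Set E3) y := by
  have hrad := radial_of_tendsto ha hδ hS hY hy hyr hgood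
  have hr : 0 < r - ‖y‖ := by linarith
  -- the limit is `δ`-separated (closed class)
  have hYsep : ∀ u ∈ Y, ∀ v ∈ Y, u ≠ v → δ ≤ dist u v :=
    (LocalConfig.isClosed_setOf_separated δ).mem_of_tendsto hY (Eventually.of_forall hS)
  -- a fine matching scale
  set η : ℝ := min (δ / 4) (min (a / 50) (min ((r - ‖y‖) / 2) 1)) with hη_def
  have hη : 0 < η := lt_min (by positivity) (lt_min (by positivity) (lt_min (by positivity) one_pos))
  have hηδ : η ≤ δ / 4 := min_le_left _ _
  have hηa : η ≤ a / 50 := (min_le_right _ _).trans (min_le_left _ _)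
  have hηr : η ≤ (r - ‖y‖) / 2 := ((min_le_right _ _).trans (min_le_right _ _)).trans (min_le_left _ _)
  have hη1 : η ≤ 1 := ((min_le_right _ _).trans (min_le_right _ _)).trans (min_le_right _ _)
  obtain ⟨k, hmatch, hgk⟩ :=
    (((LocalConfig.tendsto_iff_locallyMatches.1 hY) (‖y‖ + 1 + 2 * a) η hη).and hgood).exists
  obtain ⟨p, hp, hyp⟩ := hmatch.2 y hy (by linarith)
  have hpn : ‖p‖ ≤ ‖y‖ + η := by
    have h1 := norm_sub_norm_le p y
    rw [← dist_eq_norm, dist_comm] at h1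
    linarith
  have hg : GappedTwelve a (S k : Set E3) p := hgk p hp (by linarith)
  exact gappedTwelve_transfer ha hδ hη.le (by linarith) (by linarith) (hS k) hYsep hmatch.symm hp hy
    (by rw [dist_comm]; exact hyp) (by linarith) hg hrad


/-! ## §4 Covariance, index ↔ point, counting (COPIED from the pre-repair workfile; `fourRegSite_translate_iff` new) -/

/-- The bond shell of a re-rooted configuration is the re-rooted bond shell. -/
theorem shell_translate (a : ℝ) (Y : Set E3) (y v : E3) :
    {w ∈ (fun w => w - v) '' Y | w ≠ y - v ∧ dist (y - v) w ≤ a * (1 + 1 / 50)} =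
      (fun w => w - v) '' {w ∈ Y | w ≠ y ∧ dist y w ≤ a * (1 + 1 / 50)} := by
  ext w'
  constructor
  · rintro ⟨⟨w, hw, rfl⟩, hne, hd⟩
    exact ⟨w, ⟨hw, fun h => hne (by rw [h]), by rwa [dist_sub_right] at hd⟩, rfl⟩
  · rintro ⟨w, ⟨hw, hne, hd⟩, rfl⟩
    exact ⟨⟨w, hw, rfl⟩, fun h => hne (sub_left_injective h), by rwa [dist_sub_right]⟩

/-- Re-rooting covariance of gapped-twelve (hypothesis `hcovG` of the schema). PROVED. -/
theorem gappedTwelve_translate_iff (a : ℝ) (Y : Set E3) (y v : E3) :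
    GappedTwelve a ((fun w => w - v) '' Y) (y - v) ↔ GappedTwelve a Y y := by
  unfold GappedTwelve
  rw [shell_translate, Set.ncard_image_of_injective _ sub_left_injective]
  refine and_congr Iff.rfl ⟨fun h w hw hne => ?_, fun h => ?_⟩
  · have := h (w - v) ⟨w, hw, rfl⟩ (fun h' => hne (sub_left_injective h'))
    rwa [dist_sub_right] at this
  · rintro _ ⟨w, hw, rfl⟩ hne
    rw [dist_sub_right]
    exact h w hw (fun h' => hne (by rw [h']))


/-- The common-neighbour set of a re-rooted configuration is the re-rooted common-neighbour set. -/
theorem commonNbrs_translate (a : ℝ) (Y : Set E3) (y v c : E3) :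
    CommonNbrs a ((fun w => w - c) '' Y) (y - c) (v - c) = (fun w => w - c) '' CommonNbrs a Y y v := by
  ext w'
  constructor
  · rintro ⟨⟨w, hw, rfl⟩, hne1, hne2, hd1, hd2⟩
    exact ⟨w, ⟨hw, fun h => hne1 (by rw [h]), fun h => hne2 (by rw [h]),
      by rwa [dist_sub_right] at hd1, by rwa [dist_sub_right] at hd2⟩, rfl⟩
  · rintro ⟨w, ⟨hw, hne1, hne2, hd1, hd2⟩, rfl⟩
    exact ⟨⟨w, hw, rfl⟩, fun h => hne1 (sub_left_injective h), fun h => hne2 (sub_left_injective h),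
      by rwa [dist_sub_right], by rwa [dist_sub_right]⟩

/-- Re-rooting covariance of four-regular sites. PROVED. -/
theorem fourRegSite_translate_iff (a : ℝ) (Y : Set E3) (y c : E3) :
    FourRegSite a ((fun w => w - c) '' Y) (y - c) ↔ FourRegSite a Y y := by
  unfold FourRegSite
  refine and_congr (gappedTwelve_translate_iff a Y y c) ⟨fun h v hv hne hd => ?_, fun h => ?_⟩
  · have := h (v - c) ⟨v, hv, rfl⟩ (fun h' => hne (sub_left_injective h')) (by rwa [dist_sub_right])
    rwa [commonNbrs_translate, Set.ncard_image_of_injective _ sub_left_injective] at this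
  · rintro _ ⟨v, hv, rfl⟩ hne hd
    rw [commonNbrs_translate, Set.ncard_image_of_injective _ sub_left_injective]
    exact h v hv (fun h' => hne (by rw [h'])) (by rwa [dist_sub_right] at hd)

/-- Index form (the route's `RadialDefectsVanish` clause for particle `i`) ⇒ point form
(`GappedTwelve` on `range z`) for an injective configuration. PROVED. -/
theorem gappedTwelve_range_of_idx {N : ℕ} {z : Fin N → E3} (hz : Function.Injective z) {a : ℝ}
    {i : Fin N}
    (h : (Finset.univ.filter fun j : Fin N => j ≠ i ∧ dist (z i) (z j) ≤ a * (1 + 1 / 50)).card = 12 ∧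
      ∀ j : Fin N, j ≠ i → a * (1 - 1 / 50) ≤ dist (z i) (z j) ∧
        (dist (z i) (z j) ≤ a * (1 + 1 / 50) ∨ a * (63 / 50) ≤ dist (z i) (z j))) :
    GappedTwelve a (Set.range z) (z i) := by
  classical
  obtain ⟨hcard, hrad⟩ := h
  constructor
  · have hset : {w ∈ Set.range z | w ≠ z i ∧ dist (z i) w ≤ a * (1 + 1 / 50)} =
        z '' ↑(Finset.univ.filter fun j : Fin N => j ≠ i ∧ dist (z i) (z j) ≤ a * (1 + 1 / 50)) := by
      ext w
      constructor
      · rintro ⟨⟨j, rfl⟩, hne, hd⟩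
        refine ⟨j, ?_, rfl⟩
        simp only [Finset.coe_filter, Finset.mem_univ, true_and, Set.mem_setOf_eq]
        exact ⟨fun h => hne (by rw [h]), hd⟩
      · rintro ⟨j, hj, rfl⟩
        simp only [Finset.coe_filter, Finset.mem_univ, true_and, Set.mem_setOf_eq] at hj
        exact ⟨⟨j, rfl⟩, fun h => hj.1 (hz h), hj.2⟩
    rw [hset, Set.ncard_image_of_injective _ hz, Set.ncard_coe_finset, hcard]
  · rintro _ ⟨j, rfl⟩ hne
    exact hrad j (fun h => hne (by rw [h]))

/-- COUNTING STEP (ball counting with the hard core): if the bad particles number at most `θN`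
frequently for every `θ > 0`, then for every radius `k`, frequently some particle has only good
particles within `k` (shadows of bad particles have at most `(2k/δ + 1)³` members). PROVED. -/
theorem frequently_exists_good_ball {x : (N : ℕ) → (Fin N → E3)} {δ : ℝ} (hδ : 0 < δ)
    (hsep : ∀ N (i j : Fin N), i ≠ j → δ ≤ dist (x N i) (x N j))
    (good : (N : ℕ) → Fin N → Prop)
    (hRDV : ∀ θ : ℝ, 0 < θ → ∃ᶠ N in atTop, (Nat.card {i : Fin N // ¬ good N i} : ℝ) ≤ θ * N)
    (k : ℝ) (hk : 0 ≤ k) :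
    ∃ᶠ N in atTop, ∃ i : Fin N, ∀ j : Fin N, dist (x N j) (x N i) ≤ k → good N j := by
  classical
  set C : ℝ := (2 * k / δ + 1) ^ 3 with hC_def
  have hC : 0 < C := by positivity
  refine ((hRDV (1 / (2 * C)) (by positivity)).and_eventually (eventually_ge_atTop 1)).mono ?_
  rintro N ⟨hbad, hN1⟩
  by_contra hcon
  push Not at hcon
  choose f hf hfbad using hcon
  have hinj : Function.Injective (x N) := by
    intro i j hij
    by_contra hne
    have := hsep N i j hne
    rw [hij, dist_self] at this
    linarith
  set Bad : Finset (Fin N) := Finset.univ.filter fun j : Fin N => ¬ good N j with hBad_def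
  have hBadcard : (Bad.card : ℝ) = Nat.card {i : Fin N // ¬ good N i} := by
    rw [Nat.card_eq_fintype_card, Fintype.card_subtype]
  -- fibres of `f` are shadows of bad particles: at most `C` members each
  have hfib : ∀ j ∈ Bad, ((Finset.univ.filter fun i : Fin N => f i = j).card : ℝ) ≤ C := by
    intro j _
    have h := card_le_of_separated_of_dist_le
      ((Finset.univ.filter fun i : Fin N => f i = j).image (x N)) (x N j) hδ hk ?_ ?_
    · rw [Finset.card_image_of_injective _ hinj, finrank_euclideanSpace_fin] at h
      exact h
    · intro c hc
      obtain ⟨i, hi, rfl⟩ := Finset.mem_image.1 hc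
      have hij : f i = j := (Finset.mem_filter.1 hi).2
      rw [← hij, dist_comm]
      exact hf i
    · intro c hc d hd hcd
      obtain ⟨i, -, rfl⟩ := Finset.mem_image.1 hc
      obtain ⟨i', -, rfl⟩ := Finset.mem_image.1 hd
      exact hsep N i i' fun h => hcd (by rw [h])
  have hcover : (Finset.univ : Finset (Fin N)) ⊆
      Bad.biUnion fun j => Finset.univ.filter fun i : Fin N => f i = j := by
    intro i _
    rw [Finset.mem_biUnion]
    exact ⟨f i, Finset.mem_filter.2 ⟨Finset.mem_univ _, hfbad i⟩,
      Finset.mem_filter.2 ⟨Finset.mem_univ _, rfl⟩⟩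
  have h1 : (N : ℝ) ≤ Bad.card * C := by
    have h2 := Finset.card_le_card hcover
    rw [Finset.card_univ, Fintype.card_fin] at h2
    have h3 := Finset.card_biUnion_le (s := Bad)
      (t := fun j => Finset.univ.filter fun i : Fin N => f i = j)
    calc (N : ℝ) ≤ ((Bad.biUnion fun j => Finset.univ.filter fun i : Fin N => f i = j).card : ℝ) := by
          exact_mod_cast h2
      _ ≤ ((∑ j ∈ Bad, (Finset.univ.filter fun i : Fin N => f i = j).card : ℕ) : ℝ) := by
          exact_mod_cast h3
      _ = ∑ j ∈ Bad, ((Finset.univ.filter fun i : Fin N => f i = j).card : ℝ) := by push_cast; rfl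
      _ ≤ ∑ j ∈ Bad, C := Finset.sum_le_sum hfib
      _ = Bad.card * C := by rw [Finset.sum_const, nsmul_eq_mul]
  rw [← hBadcard] at hbad
  have hN : (1 : ℝ) ≤ N := by exact_mod_cast hN1
  have h4 : (Bad.card : ℝ) * C ≤ 1 / (2 * C) * N * C := by gcongr
  have h5 : 1 / (2 * C) * N * C = N / 2 := by field_simp
  linarith


/-! ## §5 The hull as a Mathlib ω-limit set (COPIED from the pre-repair workfile) -/

section Hull

/-! ## Card A — the hull as a Mathlib ω-limit set in the compact rubber space `LocalConfig E3` -/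

/-- The `N`-th cluster as a point configuration. -/
def cfg (x : (N : ℕ) → (Fin N → E3)) (N : ℕ) : LocalConfig E3 := ⟨Set.range (x N)⟩

/-- The HULL of a sequence of finite configurations: the ω-limit, as the particle number
`N → ∞` (`Filter.atTop`), of the family of ALL re-rootings `(cfg x N).translate t`, `t ∈ ℝ³`, in
the compact pseudometric space `LocalConfig E3` of the local rubber topology:
`hull x = ⋂_{N₀} closure {(cfg x N).translate t | N ≥ N₀, t}`. -/
def hull (x : (N : ℕ) → (Fin N → E3)) : Set (LocalConfig E3) :=
  ω atTop (fun N (t : E3) => (cfg x N).translate t) univ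

variable {x : (N : ℕ) → (Fin N → E3)} {Y : LocalConfig E3}

/-- The hull is closed — Mathlib `isClosed_omegaLimit`. PROVED. -/
theorem isClosed_hull (x : (N : ℕ) → (Fin N → E3)) : IsClosed (hull x) :=
  isClosed_omegaLimit _ _ _

/-- The hull is invariant under re-rooting — Mathlib `mapsTo_omegaLimit` with the continuous map
`translate · y` (`LocalConfig.continuous_translate`) and `translate_translate`. PROVED: this and
`isClosed_hull` REPLACE the diagonal argument (closure of the orbit of a hull element ⊆ hull). -/
theorem translate_mem_hull (hY : Y ∈ hull x) (y : E3) : Y.translate y ∈ hull x := by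
  have h := mapsTo_omegaLimit (f := atTop) (ϕ := fun N (t : E3) => (cfg x N).translate t)
    (ϕ' := fun N (t : E3) => (cfg x N).translate t) (s := univ) (s' := univ)
    (ga := fun t => y + t) (mapsTo_univ _ _) (gb := fun S : LocalConfig E3 => S.translate y)
    (fun N t => LocalConfig.translate_translate _ _ _) (LocalConfig.continuous_translate y)
  exact h hY

/-- Limits of re-rooted clusters along a subsequence lie in the hull (definition of `ω`). PROVED. -/
theorem mem_hull_of_tendsto {φ : ℕ → ℕ} (hφ : StrictMono φ) (t : ℕ → E3)
    (h : Tendsto (fun k => (cfg x (φ k)).translate (t k)) atTop (𝓝 Y)) : Y ∈ hull x := by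
  simp only [hull, omegaLimit_def, mem_iInter]
  intro u hu
  refine mem_closure_of_tendsto h ?_
  have hev : ∀ᶠ k in atTop, φ k ∈ u := hφ.tendsto_atTop.eventually hu
  filter_upwards [hev] with k hk
  exact mem_image2_of_mem hk (mem_univ _)

/-- DICTIONARY, sequential form (FIRST LEMMA of card A): a member of the hull is the limit of
re-rooted clusters along a STRICTLY INCREASING subsequence of THE GIVEN `x`
(`mem_omegaLimit_iff_frequently` + metric balls + `Filter.extraction_forall_of_frequently`). PROVED. -/
theorem exists_seq_of_mem_hull (hY : Y ∈ hull x) :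
    ∃ (φ : ℕ → ℕ) (t : ℕ → E3), StrictMono φ ∧
      Tendsto (fun k => (cfg x (φ k)).translate (t k)) atTop (𝓝 Y) := by
  have hfr : ∀ k : ℕ, ∃ᶠ N in atTop, ∃ t : E3,
      dist ((cfg x N).translate t) Y < 1 / ((k : ℝ) + 1) := by
    intro k
    have h := (mem_omegaLimit_iff_frequently _ _ _ Y).1 hY (Metric.ball Y (1 / ((k : ℝ) + 1)))
      (Metric.ball_mem_nhds _ (by positivity))
    refine h.mono fun N hN => ?_
    obtain ⟨t, -, ht⟩ := hN
    exact ⟨t, Metric.mem_ball.1 ht⟩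
  obtain ⟨φ, hφ, hP⟩ := extraction_forall_of_frequently hfr
  choose t ht using hP
  refine ⟨φ, t, hφ, ?_⟩
  rw [Metric.tendsto_atTop]
  intro ε hε
  obtain ⟨K, hK⟩ := exists_nat_one_div_lt hε
  refine ⟨K, fun k hk => lt_of_lt_of_le (ht k) ?_⟩
  have hk' : (K : ℝ) + 1 ≤ (k : ℝ) + 1 := by
    have : (K : ℝ) ≤ k := by exact_mod_cast hk
    linarith
  have : (1 : ℝ) / ((k : ℝ) + 1) ≤ 1 / ((K : ℝ) + 1) :=
    one_div_le_one_div_of_le (by positivity) hk'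
  linarith

/-- DICTIONARY, matching form: convergence of re-rooted clusters IS the two-way matching clause of
`CleanLocalLimit` (`LocalConfig.tendsto_iff_locallyMatches`; translation `τ n = -t n`). PROVED. -/
theorem cll_clause_of_tendsto {φ : ℕ → ℕ} {t : ℕ → E3}
    (h : Tendsto (fun k => (cfg x (φ k)).translate (t k)) atTop (𝓝 Y)) :
    ∀ R ε : ℝ, 0 < ε → ∀ᶠ n in atTop,
      (∀ y ∈ (Y : Set E3), ‖y‖ ≤ R → ∃ i : Fin (φ n), dist (x (φ n) i + -t n) y ≤ ε) ∧
      (∀ i : Fin (φ n), ‖x (φ n) i + -t n‖ ≤ R →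
        ∃ y ∈ (Y : Set E3), dist (x (φ n) i + -t n) y ≤ ε) := by
  intro R ε hε
  filter_upwards [LocalConfig.tendsto_iff_locallyMatches.1 h R ε hε] with n hn
  obtain ⟨h1, h2⟩ := hn
  have hmem : ∀ i : Fin (φ n), x (φ n) i + -t n ∈ ((cfg x (φ n)).translate (t n) : Set E3) := by
    intro i
    simp only [cfg, LocalConfig.coe_translate, LocalConfig.coe_mk]
    exact ⟨x (φ n) i, ⟨i, rfl⟩, sub_eq_add_neg _ _⟩
  refine ⟨fun y hy hyR => ?_, fun i hi => ?_⟩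
  · obtain ⟨p, hp, hyp⟩ := h2 y hy hyR
    simp only [cfg, LocalConfig.coe_translate, LocalConfig.coe_mk] at hp
    obtain ⟨z, ⟨i, rfl⟩, rfl⟩ := hp
    exact ⟨i, by rw [← sub_eq_add_neg, dist_comm]; exact hyp⟩
  · obtain ⟨q, hq, hqp⟩ := h1 (x (φ n) i + -t n) (hmem i) hi
    exact ⟨q, hq, by rw [dist_comm]; exact hqp⟩


/-! ## §6 Extraction with the four-regular predicate, and the crux by name (this seat) -/

/-- From the radial statement AT ONE SCALE `a` and the three geometric cruxes: a ROOTED member of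
the hull that is gapped-twelve AND exactly four-regular EVERYWHERE.  Steps 1–3 as in the
pre-repair workfile (counting ⇒ rooted re-rootings gapped on `B(0,k)`; compactness ⇒ `Y₀ ∈ hull`,
all gapped by collar transfer); step 4': `TornFree` + `FiveFoldRationingR` ⇒ `Y₀.translate c_m`
four-regular on `B(0,m)`; second extraction, limit in the CLOSED hull; four-regularity passes to
the limit by `fourRegular_of_tendsto` (injections only). PROVED. -/
theorem exists_fourReg_rooted_mem_hull (hTF : TornFree) (hFFR : FiveFoldRationingR)
    (x : (N : ℕ) → (Fin N → E3))
    (hx : ∀ N, IsGroundState lennardJones (x N)) {a : ℝ} (ha : 0 < a)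
    (hRDVa : ∀ θ : ℝ, 0 < θ → ∃ᶠ N in atTop,
      (Nat.card {i : Fin N // ¬ ((Finset.univ.filter fun j : Fin N =>
          j ≠ i ∧ dist (x N i) (x N j) ≤ a * (1 + 1 / 50)).card = 12 ∧
        ∀ j : Fin N, j ≠ i → a * (1 - 1 / 50) ≤ dist (x N i) (x N j) ∧
          (dist (x N i) (x N j) ≤ a * (1 + 1 / 50) ∨ a * (63 / 50) ≤ dist (x N i) (x N j)))} : ℝ)
        ≤ θ * N) :
    ∃ Y ∈ hull x, (0 : E3) ∈ Y ∧ ∀ y ∈ Y, FourRegSite a (Y : Set E3) y := by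
  classical
  obtain ⟨δ, hδ, hsepGS⟩ := LennardJonesMinimalDistance_holds
  have hsep : ∀ N (i j : Fin N), i ≠ j → δ ≤ dist (x N i) (x N j) :=
    fun N i j h => hsepGS N (x N) (hx N) i j h
  have hinj : ∀ N, Function.Injective (x N) := by
    intro N i j hij
    by_contra hne
    have := hsep N i j hne
    rw [hij, dist_self] at this
    linarith
  have hsepR : ∀ N, ∀ u ∈ Set.range (x N), ∀ v ∈ Set.range (x N), u ≠ v → δ ≤ dist u v := by
    rintro N _ ⟨i, rfl⟩ _ ⟨j, rfl⟩ hne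
    exact hsep N i j fun h => hne (by rw [h])
  -- Step 1: good balls of every radius, along a strictly increasing subsequence of particle numbers
  have hfreq := fun k : ℕ => frequently_exists_good_ball hδ hsep
    (fun N i => (Finset.univ.filter fun j : Fin N =>
        j ≠ i ∧ dist (x N i) (x N j) ≤ a * (1 + 1 / 50)).card = 12 ∧
      ∀ j : Fin N, j ≠ i → a * (1 - 1 / 50) ≤ dist (x N i) (x N j) ∧
        (dist (x N i) (x N j) ≤ a * (1 + 1 / 50) ∨ a * (63 / 50) ≤ dist (x N i) (x N j)))
    hRDVa k (Nat.cast_nonneg k)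
  obtain ⟨Nk, hNk, hP⟩ := extraction_forall_of_frequently hfreq
  choose ik hik using hP
  -- Step 2: the rooted re-rootings `Z k`
  set Z : ℕ → LocalConfig E3 := fun k => (cfg x (Nk k)).translate (x (Nk k) (ik k)) with hZ_def
  have hZroot : ∀ k, (0 : E3) ∈ Z k := fun k =>
    LocalConfig.zero_mem_translate (show x (Nk k) (ik k) ∈ cfg x (Nk k) from ⟨ik k, rfl⟩)
  have hZsep : ∀ k, ∀ u ∈ Z k, ∀ v ∈ Z k, u ≠ v → δ ≤ dist u v := fun k =>
    LocalConfig.separated_translate (S := cfg x (Nk k)) (hsepR (Nk k)) _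
  have hZgood : ∀ k, ∀ p ∈ Z k, ‖p‖ ≤ k → GappedTwelve a (Z k : Set E3) p := by
    intro k p hp hpk
    rw [LocalConfig.mem_translate_iff] at hp
    obtain ⟨j, hj⟩ := hp
    have hdist : dist (x (Nk k) j) (x (Nk k) (ik k)) ≤ k := by
      rw [hj, dist_eq_norm, add_sub_cancel_right]
      exact hpk
    have hg := gappedTwelve_range_of_idx (hinj _) (hik k j hdist)
    have hp' : p = x (Nk k) j - x (Nk k) (ik k) := by rw [hj, add_sub_cancel_right]
    rw [hp']
    change GappedTwelve a ((fun z => z - x (Nk k) (ik k)) '' Set.range (x (Nk k))) _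
    exact (gappedTwelve_translate_iff a _ _ _).2 hg
  -- Step 3: first extraction; the limit is a rooted, separated, all-gapped-twelve hull element
  obtain ⟨Y₀, ψ, hψ, hlim⟩ := CompactSpace.tendsto_subseq Z
  have hlim2 : Tendsto (fun k => (cfg x (Nk (ψ k))).translate (x (Nk (ψ k)) (ik (ψ k)))) atTop
      (𝓝 Y₀) := hlim
  have hY₀hull : Y₀ ∈ hull x :=
    mem_hull_of_tendsto (hNk.comp hψ) (fun k => x (Nk (ψ k)) (ik (ψ k))) hlim2
  have hY₀rs : (0 : E3) ∈ Y₀ ∧ ∀ u ∈ Y₀, ∀ v ∈ Y₀, u ≠ v → δ ≤ dist u v :=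
    (LocalConfig.isClosed_setOf_rooted_separated hδ).mem_of_tendsto hlim
      (Eventually.of_forall fun k => ⟨hZroot _, hZsep _⟩)
  have hY₀good : ∀ y ∈ Y₀, GappedTwelve a (Y₀ : Set E3) y := by
    intro y hy
    refine gappedTwelve_of_tendsto (S := Z ∘ ψ) ha hδ (fun k => hZsep (ψ k)) hlim hy
      (lt_add_one ‖y‖) ?_
    have hev : ∀ᶠ k in atTop, ‖y‖ + 1 ≤ ((ψ k : ℕ) : ℝ) :=
      (tendsto_natCast_atTop_atTop.comp hψ.tendsto_atTop).eventually (eventually_ge_atTop _)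
    filter_upwards [hev] with k hk p hp hpr
    exact hZgood (ψ k) p hp (hpr.trans hk)
  -- Step 4': TornFree (≥ 4) and FiveFoldRationingR (≤ 4) make `Y₀` four-regular on balls of every radius
  have hY₀ne : (Y₀ : Set E3).Nonempty := ⟨0, hY₀rs.1⟩
  have htf : ∀ y ∈ (Y₀ : Set E3), ∀ v ∈ (Y₀ : Set E3), v ≠ y → dist y v ≤ a * (1 + 1 / 50) →
      4 ≤ (CommonNbrs a (Y₀ : Set E3) y v).ncard :=
    hTF (Y₀ : Set E3) a ha (fun y hy => hY₀good y hy)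
  have hcentre : ∀ m : ℕ, ∃ c ∈ (Y₀ : Set E3), ∀ y ∈ (Y₀ : Set E3), dist y c ≤ m →
      FourRegSite a Y₀ y := by
    intro m
    obtain ⟨c, hc, hcm⟩ := hFFR (Y₀ : Set E3) a ha hY₀ne (fun y hy => hY₀good y hy) htf m
    exact ⟨c, hc, fun y hy hyc => ⟨hY₀good y hy, fun v hv hvy hdv =>
      le_antisymm (hcm y hy hyc v hv hvy hdv) (htf y hy v hv hvy hdv)⟩⟩
  choose c hc hcm using hcentre
  set W : ℕ → LocalConfig E3 := fun m => Y₀.translate (c m) with hW_def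
  have hWhull : ∀ m, W m ∈ hull x := fun m => translate_mem_hull hY₀hull _
  have hWroot : ∀ m, (0 : E3) ∈ W m := fun m => LocalConfig.zero_mem_translate (hc m)
  have hWsep : ∀ m, ∀ u ∈ W m, ∀ v ∈ W m, u ≠ v → δ ≤ dist u v := fun m =>
    LocalConfig.separated_translate hY₀rs.2 _
  have hWclean : ∀ m, ∀ p ∈ W m, ‖p‖ ≤ m → FourRegSite a (W m : Set E3) p := by
    intro m p hp hpm
    rw [LocalConfig.mem_translate_iff] at hp
    have hd : dist (p + c m) (c m) ≤ m := by
      rw [dist_eq_norm, add_sub_cancel_right]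
      exact hpm
    have h2 : FourRegSite a Y₀ (p + c m) := hcm m _ hp hd
    have hp' : p = p + c m - c m := (add_sub_cancel_right _ _).symm
    rw [hp']
    change FourRegSite a ((fun z => z - c m) '' (Y₀ : Set E3)) _
    exact (fourRegSite_translate_iff a _ _ _).2 h2
  -- Step 5: second extraction, limit in the CLOSED hull; both halves of `FourRegSite` pass to the limit
  obtain ⟨Y, ψ', hψ', hlim'⟩ := CompactSpace.tendsto_subseq W
  have hYhull : Y ∈ hull x :=
    (isClosed_hull x).mem_of_tendsto hlim' (Eventually.of_forall fun m => hWhull _)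
  have hYrs : (0 : E3) ∈ Y ∧ ∀ u ∈ Y, ∀ v ∈ Y, u ≠ v → δ ≤ dist u v :=
    (LocalConfig.isClosed_setOf_rooted_separated hδ).mem_of_tendsto hlim'
      (Eventually.of_forall fun m => ⟨hWroot _, hWsep _⟩)
  have hYgood : ∀ y ∈ Y, GappedTwelve a (Y : Set E3) y := by
    intro y hy
    refine gappedTwelve_of_tendsto (S := W ∘ ψ') ha hδ (fun m => hWsep (ψ' m)) hlim' hy
      (lt_add_one ‖y‖) ?_
    have hev : ∀ᶠ m in atTop, ‖y‖ + 1 ≤ ((ψ' m : ℕ) : ℝ) :=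
      (tendsto_natCast_atTop_atTop.comp hψ'.tendsto_atTop).eventually (eventually_ge_atTop _)
    filter_upwards [hev] with m hm p hp hpr
    exact (hWclean (ψ' m) p hp (hpr.trans hm)).1
  refine ⟨Y, hYhull, hYrs.1, fun y hy => ⟨hYgood y hy, ?_⟩⟩
  refine fourRegular_of_tendsto (S := W ∘ ψ') ha hδ (fun m => hWsep (ψ' m)) hlim' hy hYgood ?_
  intro ρ
  have hev : ∀ᶠ m in atTop, ρ ≤ ((ψ' m : ℕ) : ℝ) :=
    (tendsto_natCast_atTop_atTop.comp hψ'.tendsto_atTop).eventually (eventually_ge_atTop _)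
  filter_upwards [hev] with m hm p hp hpr
  exact hWclean (ψ' m) p hp (hpr.trans hm)

/-- **THE CRUX BY NAME** (`GappedShellCensus.CleanLimitExtractionR`, stmt-AtomisticToContinuum-18072),
Line B: `RadialDefectsVanish` gives the scale; the four-regular rooted hull element of
`exists_fourReg_rooted_mem_hull`; typing IN THE LIMIT by the trichotomy
(`fccHcpShell_of_fourRegular`); the dictionary `exists_seq_of_mem_hull` + `cll_clause_of_tendsto`
turns hull membership into the matching clause of `CleanLocalLimit`. PROVED, sorry-free. -/
theorem cleanLimitExtractionR_candidate : CleanLimitExtractionR := by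
  intro hRDV hST hTF hFFR x hx
  obtain ⟨a, ha1, ha2, hθ⟩ := hRDV x hx
  have ha : 0 < a := by linarith
  obtain ⟨Y, hY, h0, hreg⟩ := exists_fourReg_rooted_mem_hull hTF hFFR x hx ha hθ
  obtain ⟨φ, t, hφ, hT⟩ := exists_seq_of_mem_hull hY
  have hgood : ∀ y ∈ (Y : Set E3), GappedTwelve a (Y : Set E3) y := fun y hy => (hreg y hy).1
  exact ⟨(Y : Set E3), a, ha1, ha2, h0, ⟨φ, fun n => -t n, hφ, cll_clause_of_tendsto hT⟩,
    fun y hy => ⟨hgood y hy, fccHcpShell_of_fourRegular hST ha hgood hy (hreg y hy).2⟩⟩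

end Hull

end Summit.AtomisticToContinuum.Crystallization.Cruxes.CleanLimitExtractionR.CandidateB

end
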